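import Literature.Topology.FourManifolds.HandleBoundarySqueeze
import Literature.Topology.FourManifolds.HandleSlabLevel
import Literature.Topology.FourManifolds.CorkDecompositionSplittingProof
import Literature.Topology.FourManifolds.BoundaryFlowout
import Literature.Topology.FourManifolds.SmoothEmbeddingCriteria
import HarnessLib

/-!
# The boundary tube `S¹ × ℝ² ↪ S³` of a 2-handle attaching map over the 4-disc

Topic `Literature/Topology/FourManifolds`; second layer (after `HandleBoundarySqueeze.lean`) of
reading a Kosinski attachment `D⁴ ∪_h̄ H²` (`HandleAttachingMap 3 2 (𝔻 4)`,
`HandleAttachingMap.IsMultiAttachment`, Kosinski 1993, VI §6) as a Kirby trace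
(`FramedLink.IsTrace`, `DottedCircleDiagram.Realization`, Kirby 1989, Ch. I §2), whose 2-handles
are attached along oriented tubular neighbourhoods `ν : S¹ × ℝ² ↪ S³ = ∂D⁴` of knots, the
attaching map being `ν` on the unit disc bundle of `T ∩ ∂D⁴`.

For an attaching map `h̄ : T → D⁴` of a 2-handle and a shrinking scale `0 < ε`, `2ε ≤ 1`, the
**boundary tube** `HandleAttachingMap.sphereTube h̄ : S¹ × ℝ² → S³`,
`(θ, v) ↦ h̄ (θ, φ_ε v, 0)` read in `S³ = ∂D⁴` (`closedBallBoundaryData 3`; `φ_ε` the fibre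
squeeze of `HandleBoundarySqueeze.lean`, a diffeomorphism of `ℝ²` onto the disc `‖w‖² < 2ε ≤ 1`):

* `incl_sphereTube` — `incl (sphereTube h̄ (θ, v)) = h̄ (θ, φ_ε v, 0)`;
* `shrink_eq_incl_sphereTube` — **the shrunken attaching map `h̄ ∘ ρ_ε` is the boundary tube on
  the unit disc bundle of `T ∩ ∂D⁴`**: `(h̄ ∘ ρ_ε) y = incl (sphereTube h̄ (angle y, fibre y))`
  for `y` of depth `0` — the clause `carvedEmbed_handle` of `DottedCircleDiagram.Realization`;
* `isSmoothEmbedding_sphereTube` — **the boundary tube is a smooth embedding** of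
  `S¹ × ℝ²` into `S³` (smooth by factorisation through the immersion `S³ ↪ D⁴`; an open map
  because `h̄` is open and preserves boundary points, `mem_boundary_iff_of_isSmoothEmbedding`; the
  inverse `(angle, φ_ε⁻¹ ∘ fibre) ∘ h̄⁻¹ ∘ incl` is smooth on the range), with open range;
* `sphereTube_zero` — its core `θ ↦ sphereTube h̄ (θ, 0)` is the attaching circle of `h̄`.

Everything here is proved; no named facts are introduced.

## References

* A. A. Kosinski, *Differential Manifolds*, Academic Press (1993), VI §6. [Kosinski1993]
* R. C. Kirby, *The Topology of 4-Manifolds*, LNM 1374 (1989), Ch. I §1–2. [Kirby1989]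
-/

open scoped Manifold ContDiff Topology
open Set Function Metric Filter Real

noncomputable section

namespace Literature.Topology.FourManifolds

universe u

/-- Local notation: `𝔼 n` is the model Euclidean space `EuclideanSpace ℝ (Fin n)`. -/
local notation "𝔼 " n:arg => EuclideanSpace ℝ (Fin n)

/-- Local notation: `𝕊 n` is the unit sphere in `EuclideanSpace ℝ (Fin (n + 1))`. -/
local notation "𝕊 " n:arg => (Metric.sphere (0 : EuclideanSpace ℝ (Fin (n + 1))) 1)

/-- Local notation: `𝔻 n` is the closed unit ball in `EuclideanSpace ℝ (Fin n)`. -/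
local notation "𝔻 " n:arg => (Metric.closedBall (0 : EuclideanSpace ℝ (Fin n)) 1)

set_option quotPrecheck false in
/-- Local notation: Kosinski's tube `T ⊆ D⁴` of the circle `S¹ × 0`, as a type. -/
local notation "𝕋" => ↥(handleTube 3 2)

attribute [local instance] fact_finrank_euclideanSpace_succ

open HandleShrink

/-- The boundary sphere of `D⁴` is nonempty (for the left inverse `incl⁻¹`). [folklore] -/
instance nonempty_sphere_three_boundaryCarrier : Nonempty (closedBallBoundaryData 3).carrier :=
  ⟨(⟨EuclideanSpace.single 0 1, by
    rw [mem_sphere_zero_iff_norm, PiLp.norm_single, norm_one]⟩ : 𝕊 3)⟩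

/-- `S¹ × ℝ²` is nonempty. [folklore] -/
instance nonempty_circle_prod_plane : Nonempty ((𝕊 1) × (𝔼 2)) :=
  ⟨(⟨EuclideanSpace.single 0 1, by rw [mem_sphere_zero_iff_norm, PiLp.norm_single, norm_one]⟩, 0)⟩

namespace HandleAttachingMap

variable {ε : ℝ} (h : HandleAttachingMap 3 2 (𝔻 4)) (hε : 0 < ε) (hε2 : 2 * ε ≤ 1)

include hε hε2

/-! ### §1 The boundary tube and its values -/

/-- Room at depth `0` for the squeezed fibre `φ_ε v` (`‖φ_ε v‖² < 2ε ≤ 1`). [folklore] -/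
theorem depth_zero_pos_fibreSqueeze (v : 𝔼 2) : 0 < 1 - 0 - ‖fibreSqueeze ε v‖ ^ 2 :=
  depth_zero_pos ((norm_fibreSqueeze_sq_lt hε v).trans_le hε2)

/-- **The point `(θ, φ_ε v, 0)` of `T ∩ ∂D⁴`.** [folklore] -/
def sphereTubePt (θ : 𝕊 1) (v : 𝔼 2) : 𝕋 :=
  mkTubePt θ (fibreSqueeze ε v) 0 le_rfl (depth_zero_pos_fibreSqueeze hε hε2 v)

/-- Its angle is `θ`. [folklore] -/
@[simp] theorem tubeAngle_sphereTubePt (θ : 𝕊 1) (v : 𝔼 2) :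
    tubeAngle (sphereTubePt hε hε2 θ v) = θ := tubeAngle_mkTubePt _ _ _ _ _

/-- Its fibre is `φ_ε v`. [folklore] -/
@[simp] theorem tubeFibre_sphereTubePt (θ : 𝕊 1) (v : 𝔼 2) :
    tubeFibre (sphereTubePt hε hε2 θ v) = fibreSqueeze ε v := tubeFibre_mkTubePt _ _ _ _ _

/-- Its depth is `0`. [folklore] -/
@[simp] theorem tubeDepth_sphereTubePt (θ : 𝕊 1) (v : 𝔼 2) :
    tubeDepth (sphereTubePt hε hε2 θ v) = 0 := tubeDepth_mkTubePt _ _ _ _ _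

/-- It lies on the boundary sphere. [folklore] -/
theorem norm_tubeVec_sphereTubePt (θ : 𝕊 1) (v : 𝔼 2) :
    ‖tubeVec (sphereTubePt hε hε2 θ v)‖ = 1 :=
  (tubeDepth_eq_zero_iff _).1 (tubeDepth_sphereTubePt hε hε2 θ v)

/-- `(θ, v) ↦ (θ, φ_ε v, 0)` is injective. [folklore] -/
theorem injective_sphereTubePt : Injective fun p : (𝕊 1) × (𝔼 2) => sphereTubePt hε hε2 p.1 p.2 := by
  rintro ⟨θ, v⟩ ⟨θ', v'⟩ hp
  have h1 := congrArg tubeAngle hp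
  have h2 := congrArg tubeFibre hp
  simp only [tubeAngle_sphereTubePt, tubeFibre_sphereTubePt] at h1 h2
  rw [h1, injective_fibreSqueeze hε h2]

/-- **`h̄ (θ, φ_ε v, 0)` is a boundary point of `D⁴`.** [cite: Kosinski1993, VI §6] -/
theorem apply_sphereTubePt_mem_range_incl (θ : 𝕊 1) (v : 𝔼 2) :
    h.toFun (sphereTubePt hε hε2 θ v) ∈ range (closedBallBoundaryData 3).incl := by
  rw [(closedBallBoundaryData 3).range_incl]
  exact h.isBoundaryPoint _ (norm_tubeVec_sphereTubePt hε hε2 θ v)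

/-- **The boundary tube `S¹ × ℝ² → S³` of the attaching map `h̄`**: `(θ, v) ↦ h̄ (θ, φ_ε v, 0)`
read in `S³ = ∂D⁴`. [cite: Kosinski1993, VI §6] -/
def sphereTube (p : (𝕊 1) × (𝔼 2)) : 𝕊 3 :=
  (closedBallBoundaryData 3).inclInv (h.toFun (sphereTubePt hε hε2 p.1 p.2))

/-- **`incl ∘ sphereTube = h̄ ∘ (θ, φ_ε v, 0)`.** [folklore] -/
theorem incl_sphereTube (p : (𝕊 1) × (𝔼 2)) :
    (closedBallBoundaryData 3).incl (h.sphereTube hε hε2 p) = h.toFun (sphereTubePt hε hε2 p.1 p.2) := by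
  rw [sphereTube, (closedBallBoundaryData 3).incl_inclInv]
  rw [← (closedBallBoundaryData 3).range_incl]
  exact h.apply_sphereTubePt_mem_range_incl hε hε2 p.1 p.2

/-- `incl ∘ sphereTube` as functions. [folklore] -/
theorem incl_comp_sphereTube :
    (closedBallBoundaryData 3).incl ∘ h.sphereTube hε hε2 =
      fun p => h.toFun (sphereTubePt hε hε2 p.1 p.2) :=
  funext (h.incl_sphereTube hε hε2)

/-- **The boundary tube is injective.** [folklore] -/
theorem injective_sphereTube : Injective (h.sphereTube hε hε2) := fun p q hpq => by
  have := congrArg (closedBallBoundaryData 3).incl hpq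
  rw [h.incl_sphereTube, h.incl_sphereTube] at this
  exact injective_sphereTubePt hε hε2 (h.injective this)

/-- **The shrunken attaching map `h̄ ∘ ρ_ε` is the boundary tube on the unit disc bundle of
`T ∩ ∂D⁴`**: for `y ∈ T` of depth `0`, `(h̄ ∘ ρ_ε) y = incl (sphereTube h̄ (angle y, fibre y))`
— the clause `carvedEmbed_handle` of `DottedCircleDiagram.Realization`. [cite: Kirby1989, Ch. I §2] -/
theorem shrink_eq_incl_sphereTube (y : 𝕋) (hy : tubeDepth y = 0) :
    (h.shrink hε hε2).toFun y =
      (closedBallBoundaryData 3).incl (h.sphereTube hε hε2 (tubeAngle y, tubeFibre y)) := by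
  have hv : ‖tubeFibre y‖ ^ 2 < 1 := by
    have := norm_tubeFibre_lt_one y
    nlinarith [norm_nonneg (tubeFibre y)]
  have hy' : y = mkTubePt (tubeAngle y) (tubeFibre y) 0 le_rfl (depth_zero_pos hv) := by
    have hpos : 0 < 1 - tubeDepth y - ‖tubeFibre y‖ ^ 2 := by rw [hy]; exact depth_zero_pos hv
    conv_lhs => rw [← mkTubePt_tube y (tubeDepth_nonneg y) hpos]
    apply Subtype.ext; apply Subtype.ext
    show mkVec _ _ _ = mkVec _ _ _
    rw [hy]
  rw [h.incl_sphereTube hε hε2]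
  conv_lhs => rw [hy']
  exact h.shrink_mkTubePt hε hε2 (tubeAngle y) hv

/-- **The core of the boundary tube is the attaching circle**: `sphereTube h̄ (θ, 0)` is the
point `h̄ (θ, 0, 0)` of the attaching circle, read in `S³`. [cite: Kosinski1993, VI §6] -/
theorem incl_sphereTube_zero (θ : 𝕊 1) :
    (closedBallBoundaryData 3).incl (h.sphereTube hε hε2 (θ, 0)) = h.attachingCircle θ := by
  rw [h.incl_sphereTube hε hε2]
  show h.toFun _ = h.toFun (coreTubePt θ)
  congr 1
  have hv : ‖(0 : 𝔼 2)‖ ^ 2 < 1 := by rw [norm_zero]; norm_num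
  have h1 : coreTubePt θ = mkTubePt θ 0 0 le_rfl (depth_zero_pos hv) := by
    have hpos : 0 < 1 - tubeDepth (coreTubePt θ) - ‖tubeFibre (coreTubePt θ)‖ ^ 2 := by
      rw [tubeDepth_coreTubePt, tubeFibre_coreTubePt, norm_zero]; norm_num
    conv_lhs => rw [← mkTubePt_tube (coreTubePt θ) (tubeDepth_nonneg _) hpos]
    apply Subtype.ext; apply Subtype.ext
    show mkVec _ _ _ = mkVec _ _ _
    rw [tubeAngle_coreTubePt, tubeFibre_coreTubePt, tubeDepth_coreTubePt]
  rw [h1]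
  apply Subtype.ext; apply Subtype.ext
  show mkVec _ _ _ = mkVec _ _ _
  rw [fibreSqueeze_zero]

/-! ### §2 Smoothness -/

/-- `(θ, v) ↦ (θ, φ_ε v, 0) ∈ T` is smooth. [folklore] -/
theorem contMDiff_sphereTubePt :
    ContMDiff ((𝓡 1).prod 𝓘(ℝ, 𝔼 2)) (𝓡∂ 4) ∞ fun p : (𝕊 1) × (𝔼 2) => sphereTubePt hε hε2 p.1 p.2 := by
  intro p
  apply contMDiffAt_handleTube_mk
  have h1 : ContMDiffOn ((𝓡 1).prod 𝓘(ℝ, 𝔼 2)) 𝓘(ℝ, 𝔼 4) ∞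
      (fun p : (𝕊 1) × (𝔼 2) => mkVec ((p.1 : 𝔼 2)) (fibreSqueeze ε p.2) 0) univ :=
    contMDiffOn_mkVec ((contMDiff_coe_sphere.comp contMDiff_fst).contMDiffOn)
      (((contDiff_fibreSqueeze hε).contMDiff.comp contMDiff_snd).contMDiffOn) contMDiffOn_const
      fun p _ => depth_zero_pos_fibreSqueeze hε hε2 p.2
  exact (h1 p (mem_univ p)).contMDiffAt univ_mem

/-- **The boundary tube is smooth** (factor `h̄ ∘ (θ, φ_ε v, 0)` through the immersion
`S³ ↪ D⁴`, `ContMDiff.iff_comp_isImmersion`). [folklore] -/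
theorem contMDiff_sphereTube : ContMDiff ((𝓡 1).prod 𝓘(ℝ, 𝔼 2)) (𝓡 3) ∞ (h.sphereTube hε hε2) := by
  have hsm : ContMDiff ((𝓡 1).prod 𝓘(ℝ, 𝔼 2)) (𝓡∂ 4) ∞
      ((closedBallBoundaryData 3).incl ∘ h.sphereTube hε hε2) := by
    rw [h.incl_comp_sphereTube hε hε2]
    exact h.isSmoothEmbedding.contMDiff.comp (contMDiff_sphereTubePt hε hε2)
  have hc : Continuous (h.sphereTube hε hε2) :=
    (closedBallBoundaryData 3).isSmoothEmbedding.isEmbedding.continuous_iff.2 hsm.continuous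
  exact (ContMDiff.iff_comp_isImmersion (closedBallBoundaryData 3).isSmoothEmbedding.isImmersion).2 ⟨hc, hsm⟩

/-! ### §3 The boundary tube is an open map -/

omit hε hε2 in
/-- **Boundary points of `T` are the points of norm `1`.** [folklore] -/
theorem mem_boundary_handleTube_iff (y : 𝕋) : y ∈ (𝓡∂ 4).boundary 𝕋 ↔ ‖tubeVec y‖ = 1 := by
  rw [mem_boundary_opens_iff (handleTube 3 2) y, boundary_closedBall]
  rfl

omit hε hε2 in
/-- **`h̄ y ∈ ∂D⁴` iff `y` lies on the boundary sphere** (open smooth embeddings preserve boundary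
points). [cite: Kosinski1993, VI §6] -/
theorem apply_mem_range_incl_iff (y : 𝕋) :
    h.toFun y ∈ range (closedBallBoundaryData 3).incl ↔ tubeDepth y = 0 := by
  rw [(closedBallBoundaryData 3).range_incl,
    mem_boundary_iff_of_isSmoothEmbedding h.isSmoothEmbedding h.isOpen_range y,
    mem_boundary_handleTube_iff, tubeDepth_eq_zero_iff]

omit hε2 in
/-- The set of tube points read back in `S¹ × ℝ²` through `φ_ε⁻¹`, meeting a given open set:
it is open. [folklore] -/
theorem isOpen_preimage_coords {U : Set ((𝕊 1) × (𝔼 2))} (hU : IsOpen U) :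
    IsOpen {y : 𝕋 | ‖tubeFibre y‖ ^ 2 < 2 * ε ∧ (tubeAngle y, fibreUnsqueeze ε (tubeFibre y)) ∈ U} := by
  have hO : IsOpen {y : 𝕋 | ‖tubeFibre y‖ ^ 2 < 2 * ε} :=
    isOpen_lt ((continuous_norm.comp contMDiff_tubeFibre.continuous).pow 2) continuous_const
  have hc : ContinuousOn (fun y : 𝕋 => (tubeAngle y, fibreUnsqueeze ε (tubeFibre y)))
      {y : 𝕋 | ‖tubeFibre y‖ ^ 2 < 2 * ε} := by
    intro y hy
    exact (contMDiff_tubeAngle.continuous.continuousAt.prodMk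
      ((contDiffAt_fibreUnsqueeze hε hy).continuousAt.comp
        contMDiff_tubeFibre.continuous.continuousAt)).continuousWithinAt
  exact hc.isOpen_inter_preimage hO hU

/-- **The image of an open set under the boundary tube**: `sphereTube '' U` is the preimage
under `incl` of the open set `h̄(V)`, `V` the tube points whose coordinates `(angle, φ_ε⁻¹ fibre)`
lie in `U`. [folklore] -/
theorem image_sphereTube_eq {U : Set ((𝕊 1) × (𝔼 2))} :
    h.sphereTube hε hε2 '' U = (closedBallBoundaryData 3).incl ⁻¹' (h.toFun ''
      {y : 𝕋 | ‖tubeFibre y‖ ^ 2 < 2 * ε ∧ (tubeAngle y, fibreUnsqueeze ε (tubeFibre y)) ∈ U}) := by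
  ext x
  constructor
  · rintro ⟨⟨θ, v⟩, hp, rfl⟩
    refine ⟨sphereTubePt hε hε2 θ v, ⟨?_, ?_⟩, (h.incl_sphereTube hε hε2 (θ, v)).symm⟩
    · rw [tubeFibre_sphereTubePt]; exact norm_fibreSqueeze_sq_lt hε v
    · rw [tubeAngle_sphereTubePt, tubeFibre_sphereTubePt, fibreUnsqueeze_fibreSqueeze hε]
      exact hp
  · rintro ⟨y, ⟨hy2, hyU⟩, hyx⟩
    -- `y` is a boundary point, of depth `0`
    have hy0 : tubeDepth y = 0 := (h.apply_mem_range_incl_iff y).1 ⟨x, hyx.symm⟩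
    set v := fibreUnsqueeze ε (tubeFibre y) with hv
    have hφ : fibreSqueeze ε v = tubeFibre y := fibreSqueeze_fibreUnsqueeze hε hy2
    have hy' : sphereTubePt hε hε2 (tubeAngle y) v = y := by
      have hfib : ‖tubeFibre y‖ ^ 2 < 1 := by
        have := norm_tubeFibre_lt_one y
        nlinarith [norm_nonneg (tubeFibre y)]
      have hpos : 0 < 1 - tubeDepth y - ‖tubeFibre y‖ ^ 2 := by rw [hy0]; exact depth_zero_pos hfib
      conv_rhs => rw [← mkTubePt_tube y (tubeDepth_nonneg y) hpos]
      apply Subtype.ext; apply Subtype.ext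
      show mkVec _ _ _ = mkVec _ _ _
      rw [hφ, hy0]
    refine ⟨(tubeAngle y, v), hyU, (closedBallBoundaryData 3).injective_incl ?_⟩
    rw [h.incl_sphereTube hε hε2, ← hyx]
    exact congrArg h.toFun hy'

/-- **The boundary tube is an open map.** [folklore] -/
theorem isOpenMap_sphereTube : IsOpenMap (h.sphereTube hε hε2) := fun U hU => by
  rw [h.image_sphereTube_eq hε hε2]
  exact (h.isOpenMap_toFun _ (isOpen_preimage_coords hε hU)).preimage
    (closedBallBoundaryData 3).isSmoothEmbedding.contMDiff.continuous

/-- The boundary tube has open range. [folklore] -/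
theorem isOpen_range_sphereTube : IsOpen (range (h.sphereTube hε hε2)) := by
  rw [← image_univ]; exact h.isOpenMap_sphereTube hε hε2 _ isOpen_univ

/-- The boundary tube is an open topological embedding. [folklore] -/
theorem isOpenEmbedding_sphereTube : Topology.IsOpenEmbedding (h.sphereTube hε hε2) :=
  .of_continuous_injective_isOpenMap (h.contMDiff_sphereTube hε hε2).continuous
    (h.injective_sphereTube hε hε2) (h.isOpenMap_sphereTube hε hε2)

/-! ### §4 The inverse and the embedding -/

/-- **The inverse of the boundary tube** (on all of `S³`, meaningful on the range):
`x ↦ (angle, φ_ε⁻¹ fibre) (h̄⁻¹ (incl x))`. [folklore] -/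
def sphereUntube (x : 𝕊 3) : (𝕊 1) × (𝔼 2) :=
  (tubeAngle ((openEmbeddingChart h.isSmoothEmbedding h.isOpen_range).symm
      ((closedBallBoundaryData 3).incl x)),
    fibreUnsqueeze ε (tubeFibre ((openEmbeddingChart h.isSmoothEmbedding h.isOpen_range).symm
      ((closedBallBoundaryData 3).incl x))))

/-- `sphereUntube ∘ sphereTube = id`. [folklore] -/
theorem sphereUntube_sphereTube (p : (𝕊 1) × (𝔼 2)) :
    h.sphereUntube (ε := ε) (h.sphereTube hε hε2 p) = p := by
  obtain ⟨θ, v⟩ := p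
  unfold sphereUntube
  rw [h.incl_sphereTube hε hε2, openEmbeddingChart_symm_apply,
    tubeAngle_sphereTubePt, tubeFibre_sphereTubePt, fibreUnsqueeze_fibreSqueeze hε]

/-- **The inverse is smooth on the range of the boundary tube.** [folklore] -/
theorem contMDiffOn_sphereUntube :
    ContMDiffOn (𝓡 3) ((𝓡 1).prod 𝓘(ℝ, 𝔼 2)) ∞ (h.sphereUntube (ε := ε)) (range (h.sphereTube hε hε2)) := by
  set H := openEmbeddingChart h.isSmoothEmbedding h.isOpen_range with hH
  have hincl : ContMDiff (𝓡 3) (𝓡∂ 4) ∞ (closedBallBoundaryData 3).incl :=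
    (closedBallBoundaryData 3).isSmoothEmbedding.contMDiff
  have hHs : ContMDiffOn (𝓡∂ 4) (𝓡∂ 4) ∞ H.symm (range h.toFun) := by
    have := contMDiffOn_openEmbeddingChart_symm h.isSmoothEmbedding h.isOpen_range
    rwa [openEmbeddingChart_target] at this
  have hmaps : MapsTo (closedBallBoundaryData 3).incl (range (h.sphereTube hε hε2)) (range h.toFun) := by
    rintro _ ⟨p, rfl⟩
    rw [h.incl_sphereTube hε hε2]
    exact mem_range_self _
  have hcomp : ContMDiffOn (𝓡 3) (𝓡∂ 4) ∞ (fun x => H.symm ((closedBallBoundaryData 3).incl x))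
      (range (h.sphereTube hε hε2)) := hHs.comp hincl.contMDiffOn hmaps
  have hfib : ContMDiffOn (𝓡 3) 𝓘(ℝ, 𝔼 2) ∞
      (fun x => tubeFibre (H.symm ((closedBallBoundaryData 3).incl x))) (range (h.sphereTube hε hε2)) :=
    contMDiff_tubeFibre.comp_contMDiffOn hcomp
  have h2 : ContMDiffOn (𝓡 3) 𝓘(ℝ, 𝔼 2) ∞
      (fun x => fibreUnsqueeze ε (tubeFibre (H.symm ((closedBallBoundaryData 3).incl x))))
      (range (h.sphereTube hε hε2)) := by
    intro x hx
    obtain ⟨⟨θ, v⟩, rfl⟩ := hx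
    have hy : H.symm ((closedBallBoundaryData 3).incl (h.sphereTube hε hε2 (θ, v))) =
        sphereTubePt hε hε2 θ v := by
      rw [h.incl_sphereTube hε hε2, hH, openEmbeddingChart_symm_apply]
    have hlt : ‖tubeFibre (H.symm ((closedBallBoundaryData 3).incl (h.sphereTube hε hε2 (θ, v))))‖ ^ 2 <
        2 * ε := by
      rw [hy, tubeFibre_sphereTubePt]; exact norm_fibreSqueeze_sq_lt hε v
    have hcomp' : ContMDiffWithinAt (𝓡 3) 𝓘(ℝ, 𝔼 2) ∞
        (fibreUnsqueeze ε ∘ fun x => tubeFibre (H.symm ((closedBallBoundaryData 3).incl x)))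
        (range (h.sphereTube hε hε2)) (h.sphereTube hε hε2 (θ, v)) :=
      ContMDiffAt.comp_contMDiffWithinAt (g := fibreUnsqueeze ε) _
        (contDiffAt_fibreUnsqueeze hε hlt).contMDiffAt (hfib _ ⟨(θ, v), rfl⟩)
    exact hcomp'
  exact (contMDiff_tubeAngle.comp_contMDiffOn hcomp).prodMk h2

/-- **The boundary tube `S¹ × ℝ² ↪ S³` of an attaching map over `D⁴` is a smooth embedding**
(criterion `isSmoothEmbedding_of_openPartialHomeomorph` for the two boundaryless models, their
model vector spaces `ℝ¹ × ℝ²`, `ℝ³` being identified by a linear isomorphism).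
[cite: Kosinski1993, VI §6] -/
theorem isSmoothEmbedding_sphereTube :
    Manifold.IsSmoothEmbedding ((𝓡 1).prod 𝓘(ℝ, 𝔼 2)) (𝓡 3) ∞ (h.sphereTube hε hε2) := by
  have hopen := h.isOpenEmbedding_sphereTube hε hε2
  have L : (EuclideanSpace ℝ (Fin 1) × 𝔼 2) ≃L[ℝ] 𝔼 3 := ContinuousLinearEquiv.ofFinrankEq (by simp)
  have hsrc : (hopen.toOpenPartialHomeomorph (h.sphereTube hε hε2)).source = univ := rfl
  have htgt : (hopen.toOpenPartialHomeomorph (h.sphereTube hε hε2)).target =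
      range (h.sphereTube hε hε2) := by
    rw [Topology.IsOpenEmbedding.toOpenPartialHomeomorph_target]
  refine isSmoothEmbedding_of_openPartialHomeomorph (I := (𝓡 1).prod 𝓘(ℝ, 𝔼 2)) (J := 𝓡 3) (n := ∞)
    (hopen.toOpenPartialHomeomorph (h.sphereTube hε hε2)) hsrc
    ((h.contMDiff_sphereTube hε hε2).contMDiffOn) ?_ L
  rw [htgt]
  refine (h.contMDiffOn_sphereUntube hε hε2).congr fun x hx => ?_
  obtain ⟨p, rfl⟩ := hx
  rw [h.sphereUntube_sphereTube]
  exact hopen.toOpenPartialHomeomorph_left_inv (f := h.sphereTube hε hε2)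

end HandleAttachingMap

end Literature.Topology.FourManifolds
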